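import Summits.AtomisticToContinuum.FouriersLaw.Theorems.OddSectorIrreversibilityCorrectorTheoryExistence
import Summits.AtomisticToContinuum.FouriersLaw.Theorems.JunctionLocalitySuperadditiveResistanceStubPlainForwardFieldAux1
import Summits.AtomisticToContinuum.FouriersLaw.Theorems.JunctionLocalitySuperadditiveResistanceStubPlainForwardFieldAux3
import Summits.AtomisticToContinuum.FouriersLaw.Theorems.BondHeatUncertaintySubdiffusiveBondHeatKernelGibbsA

/-!
# `CorrectorTheory` (stmt-AtomisticToContinuum-14071), part 4: the Kubo corrector is smooth and solves `L u = -J`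

Helper file for support item `stmt-AtomisticToContinuum-14071`
(`OddSectorIrreversibility.CorrectorTheory`, conjunct A (1): `u ∈ C¹`, here `C^∞`).

For the pinned anharmonic chain (all parameters `> 0`), `N ≥ 1`, `T > 0`, total current
`J = ∑_i j_i` and the equilibrium kernels `P_t`: the everywhere-defined corrector
`u⋆ = ∫_{(0,∞)} P_tJ dt` of part 1 agrees Lebesgue-a.e. with a SMOOTH `u`, `L_{T,T} u = -J` holds
pointwise, and `|u| ≤ K e^{ϑH}` for every admissible `ϑ` (`corrector_smooth`). Proof = the tree's
hypoelliptic Poisson pipeline of `JunctionLocalitySuperadditiveResistanceStubPlainForwardField*`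
(time-integrated backward equation with energy cutoffs, `τ → ∞`, Hörmander's Theorem 1.1 for
`L = X_L² + X_R² + Y`, Green's formula), run with the observable `k = J` (smooth,
`|J| ≤ M e^{ϑH}`, decaying averages by CEHR (2.5) and `μ_T(J) = 0`).

References: Cuneo–Eckmann–Hairer–Rey-Bellet 2018, Thm 2.13; L. Hörmander, Acta Math. 119 (1967),
Thm 1.1; Kundu–Dhar–Narayan 2009 (the corrector). Nothing here closes the item.
-/

noncomputable section

open MeasureTheory ProbabilityTheory Filter Topology Set Function
open scoped NNReal ENNReal ContDiff
open Literature.MathematicalPhysics.KineticTheory.HeatConduction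
open Literature.MathematicalPhysics.KineticTheory Literature.Analysis.Distribution OscillatorChain
open Summit.AtomisticToContinuum.FouriersLaw.Theorems.SuperadditiveResistance.PlainForwardField
open Summit.AtomisticToContinuum.FouriersLaw.Theorems.SubdiffusiveBondHeat

namespace Summit.AtomisticToContinuum.FouriersLaw.Theorems.OddSectorIrreversibility.Corrector

variable {N : ℕ}

/-! ### Smoothness of the currents -/

/-- The bond currents of a chain with smooth interaction are smooth. [folklore] -/
theorem contDiff_bondCurrent (P : OscillatorChain) (hV : ContDiff ℝ ∞ P.V) (N : ℕ) (i : Fin N) :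
    ContDiff ℝ ∞ fun x : PhaseSpace N => P.bondCurrent N i x := by
  have hV' : ContDiff ℝ ∞ (deriv P.V) := (contDiff_infty_iff_deriv.1 hV).2
  unfold OscillatorChain.bondCurrent
  refine ContDiff.sum fun j _ => ?_
  split_ifs
  · exact (((((contDiff_apply ℝ ℝ i).comp contDiff_snd).add ((contDiff_apply ℝ ℝ j).comp contDiff_snd)).div_const
      2).mul (hV'.comp (((contDiff_apply ℝ ℝ j).comp contDiff_fst).sub
        ((contDiff_apply ℝ ℝ i).comp contDiff_fst)))).neg
  · exact contDiff_const

/-- The total current `J = ∑_i j_i` of the pinned chain is smooth. [folklore] -/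
theorem contDiff_totalBondCurrent (ω₂ lam β γ : ℝ) (N : ℕ) :
    ContDiff ℝ ∞ fun x : PhaseSpace N => ∑ i : Fin N, (pinnedChain ω₂ lam β γ).bondCurrent N i x :=
  ContDiff.sum fun i _ => contDiff_bondCurrent _ (pinnedChain_contDiff_V ω₂ lam β γ) N i

/-- A continuous function a.e. dominated by a continuous function is dominated everywhere.
[folklore] -/
theorem le_of_ae_le_of_continuous {f g : PhaseSpace N → ℝ} (hf : Continuous f) (hg : Continuous g)
    (h : ∀ᵐ x ∂(volume : Measure (PhaseSpace N)), f x ≤ g x) (x : PhaseSpace N) : f x ≤ g x := by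
  have hmin : (fun y => min (f y) (g y)) =ᵐ[volume] f := by
    filter_upwards [h] with y hy
    exact min_eq_left hy
  have heq := ((hf.min hg).ae_eq_iff_eq volume hf).1 hmin
  have := congrFun heq x
  rw [← this]
  exact min_le_right _ _

/-! ### The smooth corrector -/

section Pinned

variable {ω₂ lam β γ : ℝ} (hω : 0 < ω₂) (hl : 0 < lam) (hβ : 0 < β) (hγ : 0 < γ) {T : ℝ} (hT : 0 < T)
  (hN : 0 < N)
include hω hl hβ hγ hT hN

/-- **The Kubo corrector is smooth and solves the Poisson equation.** For the pinned chain at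
equilibrium temperature `T` (`N ≥ 1`), kernels `P_t`, total current `J`: there is a smooth `u`
with `u⋆ := ∫_{(0,∞)} P_tJ dt = u` Lebesgue-a.e., `L_{T,T} u = -J` pointwise, and, for every
`0 < ϑ < 1/T`, `|u| ≤ K e^{ϑH}` for some `K ≥ 0`.
[cite: CuneoEckmannHairerReyBellet2018, Thm 2.13] [cite: Hormander1967, Thm 1.1] -/
theorem corrector_smooth :
    ∃ u : PhaseSpace N → ℝ, ContDiff ℝ ∞ u ∧
      (fun x => ∫ t in Set.Ioi (0 : ℝ), ∫ y, (∑ i : Fin N, (pinnedChain ω₂ lam β γ).bondCurrent N i y)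
        ∂((pinnedChain ω₂ lam β γ).transitionKernel N T T t.toNNReal x)) =ᵐ[volume] u ∧
      (∀ x, (pinnedChain ω₂ lam β γ).generator N T T u x =
        -(∑ i : Fin N, (pinnedChain ω₂ lam β γ).bondCurrent N i x)) ∧
      (∀ ϑ : ℝ, 0 < ϑ → ϑ < 1 / T → ∃ K : ℝ, 0 ≤ K ∧
        ∀ x, |u x| ≤ K * Real.exp (ϑ * (pinnedChain ω₂ lam β γ).hamiltonian N x)) := by
  haveI := isAddHaarMeasure_volume_phaseSpace N
  set P := pinnedChain ω₂ lam β γ with hP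
  have hU : ContDiff ℝ ∞ P.U := pinnedChain_contDiff_U ω₂ lam β γ
  have hV : ContDiff ℝ ∞ P.V := pinnedChain_contDiff_V ω₂ lam β γ
  have hγ' : P.γ = γ := rfl
  have hγT : 0 ≤ P.γ * T := by rw [hγ']; positivity
  set J : PhaseSpace N → ℝ := fun y => ∑ i : Fin N, P.bondCurrent N i y with hJ
  have hJs : ContDiff ℝ ∞ J := contDiff_totalBondCurrent ω₂ lam β γ N
  have hJc : Continuous J := hJs.continuous
  set Hm := P.hamiltonian N with hHm
  have hHc : Continuous Hm := pinnedChain_continuous_hamiltonian ω₂ lam β γ N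
  -- kernels: the chain pipeline's `transitionKernel` is the model-free `langevinKernel`
  have hker : ∀ t, P.langevinKernel N T T t = P.transitionKernel N T T t :=
    fun t => pinnedChain_langevinKernel_eq_transitionKernel N T T hω hl.le hβ.le hγ.le t
  -- the reference exponent `ϑ₀ = 1/(4T)`
  set ϑ₀ : ℝ := 1 / (4 * T) with hϑ₀
  have hϑ₀0 : 0 < ϑ₀ := by positivity
  have hϑ₀1 : ϑ₀ < 1 / T := by rw [hϑ₀, div_lt_div_iff₀ (by positivity) hT]; nlinarith
  obtain ⟨M, C, c, hM, hC, hc, hJM, hdecay⟩ := totalBondCurrent_decay hω hl hβ hγ hT hN hϑ₀0 hϑ₀1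
  have hdecay' : ∀ (t : ℝ≥0) (z : PhaseSpace N), |∫ y, J y ∂(P.langevinKernel N T T t z)| ≤
      (M * C) * Real.exp (ϑ₀ * Hm z) * Real.exp (-c * t) := fun t z => by
    rw [hker]; exact hdecay z t
  -- the candidate and its a-priori bound
  set g₀ : PhaseSpace N → ℝ := fun x => ∫ t in Set.Ioi (0 : ℝ),
    ∫ y, J y ∂(P.langevinKernel N T T t.toNNReal x) with hg₀
  have hg₀m : StronglyMeasurable g₀ := stronglyMeasurable_forwardIntegral hω hl.le hβ.le hγ.le hJc
  set M' : ℝ := (M * C) * ∫ t in Set.Ioi (0 : ℝ), Real.exp (-c * t) with hM'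
  have hg₀b : ∀ x, |g₀ x| ≤ M' * Real.exp (ϑ₀ * Hm x) := fun x =>
    abs_forwardIntegral_le J hc hdecay' x
  set B : PhaseSpace N → ℝ := fun x => M' * Real.exp (ϑ₀ * Hm x) with hB
  have hBc : Continuous B := by rw [hB]; fun_prop
  have hg₀B : ∀ x, ‖g₀ x‖ ≤ ‖B x‖ := fun x => by
    rw [Real.norm_eq_abs, Real.norm_eq_abs]
    exact (hg₀b x).trans (le_abs_self _)
  have hg₀loc : LocallyIntegrable g₀ volume :=
    hBc.locallyIntegrable.mono hg₀m.aestronglyMeasurable (Eventually.of_forall hg₀B)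
  -- the Poisson equation in `𝓓'`
  have hweak₀ : ∀ φ : PhaseSpace N → ℝ, ContDiff ℝ ∞ φ → HasCompactSupport φ →
      ∫ x, g₀ x * hormanderTranspose (P.drift N) (P.bathField hN T T) (fun _ => 0) φ x =
        ∫ x, (-J x) * φ x := by
    intro φ hφ hφc
    have h := integral_transpose_mul_forwardIntegral hω hl.le hβ.le hγ.le hN hT hϑ₀0 hϑ₀1 hc hJs hJM
      hdecay' hφ hφc
    calc ∫ x, g₀ x * hormanderTranspose (P.drift N) (P.bathField hN T T) (fun _ => 0) φ x
        = ∫ x, (sdeGenerator (fun y => -P.drift N y) (P.bathVecL N T) (P.bathVecR N T) φ x +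
            2 * γ * φ x) * g₀ x := by
          refine integral_congr_ae (ae_of_all _ fun x => ?_)
          dsimp only
          rw [hormanderTranspose_generatorFamily_eq_revGenerator P hU hV hN hγT hγT hφ x, hγ', mul_comm]
      _ = -∫ x, φ x * J x := h
      _ = ∫ x, (-J x) * φ x := by
          rw [← integral_neg]
          exact integral_congr_ae (ae_of_all _ fun x => by ring)
  -- hypoelliptic regularity and the classical equation
  obtain ⟨u, hu, hae⟩ := exists_smooth_ae_eq_of_weak_poisson hβ.le hγ hN hT hg₀loc hJs.neg hweak₀
  have hweak : ∀ φ : PhaseSpace N → ℝ, ContDiff ℝ ∞ φ → HasCompactSupport φ →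
      ∫ x, u x * hormanderTranspose (P.drift N) (P.bathField hN T T) (fun _ => 0) φ x =
        ∫ x, (-J x) * φ x := by
    intro φ hφ hφc
    rw [← hweak₀ φ hφ hφc]
    refine integral_congr_ae ?_
    filter_upwards [hae] with x hx
    rw [hx]
  have hclass : ∀ x, P.generator N T T u x = -J x :=
    generator_eq_of_weak_poisson P hU hV hN hγT hγT hu hJc.neg hweak
  -- the corrector with `transitionKernel` is the same function
  have hg₀' : (fun x => ∫ t in Set.Ioi (0 : ℝ), ∫ y, J y ∂(P.transitionKernel N T T t.toNNReal x)) = g₀ := by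
    funext x; simp only [hg₀, hker]
  refine ⟨u, hu, by rw [hg₀']; exact hae, hclass, fun ϑ hϑ hϑT => ?_⟩
  -- growth of `u` for an arbitrary admissible exponent
  obtain ⟨M₁, C₁, c₁, hM₁, hC₁, hc₁, -, hdecay₁⟩ := totalBondCurrent_decay hω hl hβ hγ hT hN hϑ hϑT
  have hdecay₁' : ∀ (t : ℝ≥0) (z : PhaseSpace N), |∫ y, J y ∂(P.langevinKernel N T T t z)| ≤
      (M₁ * C₁) * Real.exp (ϑ * Hm z) * Real.exp (-c₁ * t) := fun t z => by
    rw [hker]; exact hdecay₁ z t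
  set K : ℝ := (M₁ * C₁) * ∫ t in Set.Ioi (0 : ℝ), Real.exp (-c₁ * t) with hK
  have hIpos : 0 ≤ ∫ t in Set.Ioi (0 : ℝ), Real.exp (-c₁ * t) :=
    setIntegral_nonneg measurableSet_Ioi fun t _ => (Real.exp_pos _).le
  have hK0 : 0 ≤ K := by positivity
  refine ⟨K, hK0, fun x => ?_⟩
  have hptw : ∀ y, |g₀ y| ≤ K * Real.exp (ϑ * Hm y) := fun y => abs_forwardIntegral_le J hc₁ hdecay₁' y
  have hael : ∀ᵐ y ∂(volume : Measure (PhaseSpace N)), |u y| ≤ K * Real.exp (ϑ * Hm y) := by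
    filter_upwards [hae] with y hy
    rw [← hy]; exact hptw y
  exact le_of_ae_le_of_continuous (continuous_abs.comp hu.continuous) (by fun_prop) hael x

end Pinned

end Summit.AtomisticToContinuum.FouriersLaw.Theorems.OddSectorIrreversibility.Corrector

end
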